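import Mathlib
import Summits.Ventures.HodgeRepro2.InvariantWedge
import Summits.Ventures.HodgeRepro2.BallIdentityPrinciple

/-!
# Primitives of invariant 1-forms and the period homomorphism

Kernel annex of the blind cell `pub-hodge-repro2` (seat p2), Tier-3 hypothesis shapes of
`Hypothesis.lean`.  The closer of the brief transfers algebraicity through Albanese-type maps
of the compact surface `Γ\𝔹²`; in coordinates on the ball the Albanese map is given by
primitives `F` of the `Γ`-invariant holomorphic 1-forms `q` of `NonVanishingInput`
(`dF = q`), and its lattice of periods by the map `γ ↦ F(γz) − F(z)`.  This file records the
elementary part of that dictionary for ONE primitive: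

* `IsPrimitiveOf F q`: `∂ⱼF = qⱼ` on the ball;
* `fderiv_comp_ballAction_single`: the chain rule `∂ⱼ(F ∘ α) = ∑ᵢ (∂ᵢF ∘ α) · J_α` in coordinates;
* **`exists_period_of_isPrimitiveOf`**: if `q` is `α`-invariant and `F` is a primitive of `q`, then
  `F(αz) − F(z)` is CONSTANT on the ball (its differential vanishes; the ball is convex);
* `period` and **`period_mul`** / `period_one` / `period_inv`: the constant is an additive
  cocycle `U(2,1) ⊇ Γ → ℂ` — the period homomorphism of the Albanese map; `period_eq_zero_iff`:
  it vanishes on `γ` iff `F` is `γ`-invariant.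

(Existence of primitives — the Poincaré lemma on the ball — is not proved here: `IsHolomorphicOneForm`
records ℂ-differentiability only, and the ray-integral proof needs the continuity of the
derivative, unavailable in Mathlib for several complex variables.)
-/

namespace Summit.Ventures.HodgeRepro2.ShimuraData

open Matrix

/-- `F` is a primitive of the 1-form `q` on the ball: `∂ⱼF(z) = qⱼ(z)` for `z ∈ 𝔹²`. -/
def IsPrimitiveOf (F : (Fin 2 → ℂ) → ℂ) (q : (Fin 2 → ℂ) → Fin 2 → ℂ) : Prop :=
  ∀ z ∈ ball₂, ∀ j : Fin 2, fderiv ℂ F z (Pi.single j 1) = q z j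

/-- A scalar continuous linear functional on `ℂ²` is determined by its values on the basis. -/
theorem clm_apply_eq_sum_single (L : (Fin 2 → ℂ) →L[ℂ] ℂ) (v : Fin 2 → ℂ) :
    L v = ∑ i, v i * L (Pi.single i 1) := by
  have h := LinearMap.pi_apply_eq_sum_univ (L : (Fin 2 → ℂ) →ₗ[ℂ] ℂ) v
  simp only [ContinuousLinearMap.coe_coe, smul_eq_mul] at h
  rw [h]
  refine Finset.sum_congr rfl fun i _ => ?_
  congr 2
  funext j
  simp [Pi.single_apply, eq_comm]

/-- A scalar continuous linear functional vanishing on the basis vectors is zero. -/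
theorem clm_eq_zero_of_forall_single {L : (Fin 2 → ℂ) →L[ℂ] ℂ}
    (h : ∀ j : Fin 2, L (Pi.single j 1) = 0) : L = 0 := by
  ext v
  rw [clm_apply_eq_sum_single]
  simp [h]

/-- **Chain rule in coordinates**: `∂ⱼ(F ∘ α)(z) = ∑ᵢ ∂ᵢF(αz) · J_α(z)ᵢⱼ`. -/
theorem fderiv_comp_ballAction_single {α : Matrix (Fin 3) (Fin 3) ℂ} (hα : IsInU21 α)
    {F : (Fin 2 → ℂ) → ℂ} {z : Fin 2 → ℂ} (hz : z ∈ ball₂)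
    (hF : DifferentiableAt ℂ F (ballAction α z)) (j : Fin 2) :
    fderiv ℂ (F ∘ ballAction α) z (Pi.single j 1) =
      ∑ i, fderiv ℂ F (ballAction α z) (Pi.single i 1) * jacobian α z i j := by
  rw [fderiv_comp z hF (hα.differentiableAt_ballAction hz), ContinuousLinearMap.comp_apply,
    clm_apply_eq_sum_single]
  refine Finset.sum_congr rfl fun i _ => ?_
  rw [jacobian_apply, mul_comm]

/-- **The period of `F` along `α` is constant**: if `F` is a primitive of an `α`-invariant
1-form, then `F(αz) − F(z)` does not depend on `z ∈ 𝔹²`. -/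
theorem exists_period_of_isPrimitiveOf {α : Matrix (Fin 3) (Fin 3) ℂ} (hα : IsInU21 α) {F : (Fin 2 → ℂ) → ℂ}
    (hF : DifferentiableOn ℂ F ball₂) {q : (Fin 2 → ℂ) → Fin 2 → ℂ} (hFq : IsPrimitiveOf F q)
    (hq : IsInvariantUnder α q) : ∃ c : ℂ, ∀ z ∈ ball₂, F (ballAction α z) = F z + c := by
  -- the function `G = F ∘ α − F` has vanishing differential on the ball
  have hFα : DifferentiableOn ℂ (F ∘ ballAction α) ball₂ := by
    intro z hz
    exact ((hF _ (hα.ballAction_mem_ball₂ hz)).differentiableAt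
      (isOpen_ball₂.mem_nhds (hα.ballAction_mem_ball₂ hz))).comp z
      (hα.differentiableAt_ballAction hz) |>.differentiableWithinAt
  have hG : DifferentiableOn ℂ (F ∘ ballAction α - F) ball₂ := hFα.sub hF
  have hG' : ∀ z ∈ ball₂, fderivWithin ℂ (F ∘ ballAction α - F) ball₂ z = 0 := by
    intro z hz
    rw [fderivWithin_of_isOpen isOpen_ball₂ hz]
    have hFz : DifferentiableAt ℂ F z := (hF z hz).differentiableAt (isOpen_ball₂.mem_nhds hz)
    have hFαz : DifferentiableAt ℂ F (ballAction α z) :=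
      (hF _ (hα.ballAction_mem_ball₂ hz)).differentiableAt
        (isOpen_ball₂.mem_nhds (hα.ballAction_mem_ball₂ hz))
    rw [fderiv_sub (hFαz.comp z (hα.differentiableAt_ballAction hz)) hFz]
    refine clm_eq_zero_of_forall_single fun j => ?_
    rw [_root_.sub_apply, fderiv_comp_ballAction_single hα hz hFαz j, hFq z hz j,
      sub_eq_zero]
    have hinv := hq z hz j
    simp only [jacobian_apply]
    rw [← hinv]
    refine Finset.sum_congr rfl fun i _ => ?_
    rw [hFq _ (hα.ballAction_mem_ball₂ hz) i]
  refine ⟨F (ballAction α 0) - F 0, fun z hz => ?_⟩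
  have := convex_ball₂.is_const_of_fderivWithin_eq_zero hG hG' hz
    (show (0 : Fin 2 → ℂ) ∈ ball₂ by simp [ball₂])
  simp only [Pi.sub_apply, Function.comp_apply] at this
  linear_combination this

/-- The period of a primitive `F` along `α`: the constant value of `F(αz) − F(z)`, read at
the origin. -/
noncomputable def period (F : (Fin 2 → ℂ) → ℂ) (α : Matrix (Fin 3) (Fin 3) ℂ) : ℂ :=
  F (ballAction α 0) - F 0

/-- `F(αz) = F(z) + period F α` on the ball, for a primitive `F` of an `α`-invariant form. -/
theorem apply_ballAction_eq_add_period {α : Matrix (Fin 3) (Fin 3) ℂ} (hα : IsInU21 α)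
    {F : (Fin 2 → ℂ) → ℂ} (hF : DifferentiableOn ℂ F ball₂) {q : (Fin 2 → ℂ) → Fin 2 → ℂ}
    (hFq : IsPrimitiveOf F q) (hq : IsInvariantUnder α q) {z : Fin 2 → ℂ} (hz : z ∈ ball₂) :
    F (ballAction α z) = F z + period F α := by
  obtain ⟨c, hc⟩ := exists_period_of_isPrimitiveOf hα hF hFq hq
  have h0 := hc 0 (by simp [ball₂])
  rw [hc z hz, period, h0]
  ring

/-- The period along the identity is `0`. -/
theorem period_one (F : (Fin 2 → ℂ) → ℂ) : period F 1 = 0 := by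
  simp [period, ballAction_one]

/-- **The period map is an additive cocycle (a homomorphism `Γ → ℂ`)**:
`period (αβ) = period α + period β`. -/
theorem period_mul {α β : Matrix (Fin 3) (Fin 3) ℂ} (hα : IsInU21 α) (hβ : IsInU21 β)
    {F : (Fin 2 → ℂ) → ℂ} (hF : DifferentiableOn ℂ F ball₂) {q : (Fin 2 → ℂ) → Fin 2 → ℂ}
    (hFq : IsPrimitiveOf F q) (hqα : IsInvariantUnder α q) (hqβ : IsInvariantUnder β q) :
    period F (α * β) = period F α + period F β := by
  have h0 : (0 : Fin 2 → ℂ) ∈ ball₂ := by simp [ball₂]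
  have h1 := apply_ballAction_eq_add_period (hα.mul hβ) hF hFq (hqα.mul hα hβ hqβ) h0
  rw [hβ.ballAction_mul h0, apply_ballAction_eq_add_period hα hF hFq hqα (hβ.ballAction_mem_ball₂ h0),
    apply_ballAction_eq_add_period hβ hF hFq hqβ h0] at h1
  linear_combination -h1

/-- `period F α⁻¹ = −period F α`. -/
theorem period_inv {α : Matrix (Fin 3) (Fin 3) ℂ} (hα : IsInU21 α) {F : (Fin 2 → ℂ) → ℂ}
    (hF : DifferentiableOn ℂ F ball₂) {q : (Fin 2 → ℂ) → Fin 2 → ℂ} (hFq : IsPrimitiveOf F q)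
    (hq : IsInvariantUnder α q) : period F α⁻¹ = -period F α := by
  have h := period_mul hα hα.inv hF hFq hq (hq.inv hα)
  rw [Matrix.mul_nonsing_inv α hα.isUnit_det, period_one] at h
  linear_combination -h

/-- The period along `α` vanishes iff the primitive `F` is `α`-invariant on the ball. -/
theorem period_eq_zero_iff {α : Matrix (Fin 3) (Fin 3) ℂ} (hα : IsInU21 α) {F : (Fin 2 → ℂ) → ℂ}
    (hF : DifferentiableOn ℂ F ball₂) {q : (Fin 2 → ℂ) → Fin 2 → ℂ} (hFq : IsPrimitiveOf F q)
    (hq : IsInvariantUnder α q) :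
    period F α = 0 ↔ ∀ z ∈ ball₂, F (ballAction α z) = F z := by
  constructor
  · intro h z hz
    rw [apply_ballAction_eq_add_period hα hF hFq hq hz, h, add_zero]
  · intro h
    have := h 0 (by simp [ball₂])
    rw [period, this, sub_self]

end Summit.Ventures.HodgeRepro2.ShimuraData
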